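import Summits.AtomisticToContinuum.BoseEinsteinCondensation.Theorems.BECGroundStateSOSPeriodicIRBoundTwoSectorFloatingDefs
import Summits.AtomisticToContinuum.BoseEinsteinCondensation.Theorems.BECGroundStateSOSPeriodicIRBoundTwoSectorKLS
import HarnessLib

/-!
# Route `BECGroundStateSOS`, crux `PeriodicIRBound` (stmt-AtomisticToContinuum-3972), line `two-sector-gd-transfer` (v7) —
# stub S4' `stub_klsNearMinimiserT : KLSNearMinimiserT` (the KLS moment inequality with FREE thresholds)

Supports (does not close) stmt-AtomisticToContinuum-3972. The registered stub S4' of the v7 ("floating thresholds")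
skeleton `Cruxes/PeriodicIRBound/Lines/two_sector_gd_transfer.lean` (statement `KLSNearMinimiserT` = `∀ v` integrable
admissible, `KLSMomentForT v`, in `Theorems/BECGroundStateSOSPeriodicIRBoundTwoSectorFloatingDefs.lean`): at fixed
`(N, L) = (m+2, L)` with finite `E₀(N)`, a mode `n ≠ 0`, `b ≥ 0` and two FREE thresholds `Tp`, `Tm`, the particle-channel
inequality `ChanPlus v m L n Tp b` (at the test vectors `a†(φ_n)ψ` of near-minimisers `ψ`) and the hole-channel inequality
`ChanMinus v m L n Tm b` (at `a(φ_n)ψ`) give, for every `η > 0`, a slack `δ > 0` such that every `δ`-near-minimiser `Ψ` of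
`H_N` obeys, with `n_k = n_Ψ(φ_n)` and `y = 2n_k + 1`,
`y² ≤ 2b·[(1+η)·(|2πn/L|² + 2N‖v‖₁/L³ + E₀(N)·y − Tm·n_k − Tp·(n_k+1)) + η·(y+1)]`.

Proof: the landed S4 proof `KLS.klsMomentFor` (p138298) with its two channel blocks `hchanP` / `hchanM` replaced by the
hypotheses; everything else is unchanged — `‖aψ‖² = n_k` (`WF.normSq_modeAn`), the Wagner–Feynman form inequality
`𝓔[aψ] + 𝓔[a†ψ] ≤ (|2πn/L|² + 2N‖v‖₁/L³)‖ψ‖² + 𝓔[ψ] + 2Re B(ψ, a†aψ)` (`WF.wagnerFeynman_form_le`), the near-minimiser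
cross-term bound `|Re B(ψ, a†aψ) − E₀(N)·n_k| ≤ √δ·√𝓔[a†aψ]` (`WF.abs_formRe_sub_le`, `WF.innerRe_numOp`) with the a priori
bound `𝓔[a†aψ] ≤ K_b` (`WF.qform_modeAn_le`, `WF.qform_modeCr_le`), the slack `δ = min(δ₊(η), δ₋(η), δ₀)` with
`(1+η)(δ₀ + 2√δ₀√K_b) ≤ η` (`KLS.exists_slack`) and the real-arithmetic core `KLS.real_core` (generic in the three
energies, here `e1 := Tm`, `e3 := Tp`). No open mathematics. References (shape only; nothing is cited as a fact):
T. Kennedy, E. H. Lieb, B. S. Shastry, J. Stat. Phys. 53 (1988) 1019, (12)–(14); H. Wagner, Z. Physik 195 (1966) 273, §2.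
-/

noncomputable section

open scoped BigOperators ENNReal ComplexConjugate
open Filter MeasureTheory

namespace Summit.AtomisticToContinuum.BoseEinsteinCondensation.Cruxes.PeriodicIRBound.TwoSectorGdTransfer

open Literature.MathematicalPhysics.QuantumManyBody.BoseGas
open Summit.AtomisticToContinuum.BoseEinsteinCondensation.Cruxes.PeriodicIRBound.LinearPhFloorWagner.WF

namespace KLS

/-! ### Small conversions -/

/-- `toReal` of a coefficient `(m + 1 : ℝ≥0∞)`. -/
private theorem toReal_natCast_add_one (m : ℕ) : ((m : ℝ≥0∞) + 1).toReal = (m : ℝ) + 1 := by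
  rw [ENNReal.toReal_add (ENNReal.natCast_ne_top m) ENNReal.one_ne_top, ENNReal.toReal_natCast,
    ENNReal.toReal_one]

/-- `(m + 1 : ℝ≥0∞) ≠ ⊤`. -/
private theorem natCast_add_one_ne_top (m : ℕ) : ((m : ℝ≥0∞) + 1) ≠ ⊤ :=
  ENNReal.add_ne_top.2 ⟨ENNReal.natCast_ne_top m, ENNReal.one_ne_top⟩

/-! ### The KLS moment inequality at a near-minimiser, free thresholds -/

/-- **The per-potential KLS moment inequality with free thresholds** `KLSMomentForT v` for an integrable admissible `v`
(stub S4', names inlined): see the module docstring for the chain. -/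
theorem klsMomentForT (v : ℝ → ℝ≥0∞) (hv : IsRepulsiveFiniteRange v) (hint : (∫⁻ x : Space, v ‖x‖) ≠ ⊤) :
    KLSMomentForT v := by
  intro m L hL hE2 n hn b hb Tp Tm hP hM η hη
  have hw : Measurable v := hv.1
  -- notation
  set E₀ : ℝ≥0∞ := periodicGroundStateEnergy v (m + 2) L with hE₀
  set e0 : ℝ := E₀.toReal with he0
  set V₁ : ℝ := (∫⁻ x : Space, v ‖x‖).toReal with hV₁
  have hV₁0 : 0 ≤ V₁ := ENNReal.toReal_nonneg
  set pv : Space := latticeVec (2 * Real.pi / L) n with hpv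
  set D : ℝ := ‖pv‖ ^ 2 + 2 * ((m : ℝ) + 2) * V₁ / L ^ 3 with hD
  -- the a priori constant for `𝓔[a†aψ]`
  set cB : ℝ := ‖pv‖ ^ 2 + ((m : ℝ) + 1) * V₁ / L ^ 3 with hcB
  have hcB0 : 0 ≤ cB := by positivity
  set Kb : ℝ := ((m : ℝ) + 2) * (((m : ℝ) + 2) * (e0 + 1) + cB * ((m : ℝ) + 2)) with hKb
  -- the slacks: the two channels at `η`, and `δ₀` absorbing the polar error
  obtain ⟨δ₀, hδ₀, hδ₀1, hslack⟩ := KLS.exists_slack (Kb := Kb) hη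
  obtain ⟨δP, hδP, HP⟩ := hP η hη
  obtain ⟨δM, hδM, HM⟩ := hM η hη
  set δ : ℝ≥0∞ := min (min δP δM) (ENNReal.ofReal δ₀) with hδdef
  have hδpos : 0 < δ := lt_min (lt_min hδP hδM) (ENNReal.ofReal_pos.2 hδ₀)
  have hδleP : δ ≤ δP := (min_le_left _ _).trans (min_le_left _ _)
  have hδleM : δ ≤ δM := (min_le_left _ _).trans (min_le_right _ _)
  have hδle0 : δ ≤ ENNReal.ofReal δ₀ := min_le_right _ _
  have hδtop : δ ≠ ⊤ := ne_top_of_le_ne_top ENNReal.ofReal_ne_top hδle0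
  refine ⟨δ, hδpos, fun Ψ hΨ => ?_⟩
  -- ===== the per-state bound =====
  -- the two channel inequalities at `Ψ` (a `δP`- and a `δM`-near-minimiser)
  have hchanP := HP Ψ (le_trans hΨ (add_le_add le_rfl hδleP))
  have hchanM := HM Ψ (le_trans hΨ (add_le_add le_rfl hδleM))
  simp only at hchanP hchanM
  set δr : ℝ := δ.toReal with hδr
  have hδr0 : 0 ≤ δr := ENNReal.toReal_nonneg
  have hδrle : δr ≤ δ₀ := by
    have h := ENNReal.toReal_mono ENNReal.ofReal_ne_top hδle0
    rwa [ENNReal.toReal_ofReal hδ₀.le] at h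
  have hslackδ := hslack δr hδr0 hδrle
  -- the state
  set ψ : Config (m + 2) → ℂ := Ψ.ψ with hψdef
  have hψc : IsCore L ψ := isCore_trialState Ψ
  have hψ1 : normSq L ψ = 1 := Ψ.norm_eq
  have hψE : qform v L ψ ≤ E₀ + δ := hΨ
  have hEδtop : E₀ + δ ≠ ⊤ := ENNReal.add_ne_top.2 ⟨hE2, hδtop⟩
  have hψEtop : qform v L ψ ≠ ⊤ := ne_top_of_le_ne_top hEδtop hψE
  set qΨ : ℝ := (qform v L ψ).toReal with hqΨ
  have hq : qΨ ≤ e0 + δr := by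
    have h := ENNReal.toReal_mono hEδtop hψE
    rwa [ENNReal.toReal_add hE2 hδtop] at h
  -- the excitation `aψ`, the particle state `a†ψ`, and `a†aψ`
  set aΨ : Config (m + 1) → ℂ := modeAn L (planeWaveMode L n) ψ with haΨ
  set cΨ : Config (m + 2 + 1) → ℂ := modeCr (planeWaveMode L n) ψ with hcΨ
  set NΨ : Config (m + 2) → ℂ := modeCr (planeWaveMode L n) aΨ with hNΨ
  have haΨc : IsCore L aΨ := isCore_modeAn hL n hψc
  have hNΨc : IsCore L NΨ := isCore_modeCr hL n haΨc
  -- mass: `‖aψ‖² = n_k`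
  set νE : ℝ≥0∞ := cellOccupation (m + 2) L (planeWaveMode L n) ψ with hνE
  have hnAE : normSq L aΨ = νE := normSq_modeAn hL n ψ
  have hνle : νE ≤ ((m + 2 : ℕ) : ℝ≥0∞) * normSq L ψ :=
    cellOccupation_le_mul_normSq hL n hψc.contDiff.continuous
  rw [hψ1, mul_one] at hνle
  have hνtop : νE ≠ ⊤ := ne_top_of_le_ne_top (ENNReal.natCast_ne_top _) hνle
  set nA : ℝ := νE.toReal with hnA
  have hnAle : nA ≤ (m : ℝ) + 2 := by
    have h := ENNReal.toReal_mono (ENNReal.natCast_ne_top _) hνle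
    rw [ENNReal.toReal_natCast] at h
    push_cast at h
    exact h
  have hnAtop : normSq L aΨ ≠ ⊤ := by rw [hnAE]; exact hνtop
  have hnAr : (normSq L aΨ).toReal = nA := by rw [hnAE]
  -- a priori energy bounds for `aψ`, `a†aψ`
  have haΨE := qform_modeAn_le hL hw n hψc
  have haΨEtop : qform v L aΨ ≠ ⊤ :=
    ne_top_of_le_ne_top (ENNReal.mul_ne_top (natCast_add_one_ne_top _) hψEtop) haΨE
  have hNΨE := qform_modeCr_le hL hw hint n haΨc
  have hNΨEtop : qform v L NΨ ≠ ⊤ :=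
    ne_top_of_le_ne_top (ENNReal.mul_ne_top (natCast_add_one_ne_top _) (ENNReal.add_ne_top.2
      ⟨haΨEtop, ENNReal.mul_ne_top ENNReal.ofReal_ne_top hnAtop⟩)) hNΨE
  set qA : ℝ := (qform v L aΨ).toReal with hqA
  set qC : ℝ := (qform v L cΨ).toReal with hqC
  set K : ℝ := (qform v L NΨ).toReal with hK
  have hqAr : qA ≤ ((m : ℝ) + 2) * qΨ := by
    have h := ENNReal.toReal_mono (ENNReal.mul_ne_top (natCast_add_one_ne_top _) hψEtop) haΨE
    rw [ENNReal.toReal_mul, toReal_natCast_add_one] at h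
    push_cast at h
    linarith
  have hKr : K ≤ ((m : ℝ) + 2) * (qA + cB * nA) := by
    have h := ENNReal.toReal_mono (ENNReal.mul_ne_top (natCast_add_one_ne_top _) (ENNReal.add_ne_top.2
      ⟨haΨEtop, ENNReal.mul_ne_top ENNReal.ofReal_ne_top hnAtop⟩)) hNΨE
    rw [ENNReal.toReal_mul, toReal_natCast_add_one, ENNReal.toReal_add haΨEtop
      (ENNReal.mul_ne_top ENNReal.ofReal_ne_top hnAtop), ENNReal.toReal_mul,
      ENNReal.toReal_ofReal (by positivity), hnAr] at h
    push_cast at h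
    have hc : ‖pv‖ ^ 2 + ((m : ℝ) + 1) * V₁ / L ^ 3 = cB := by rw [hcB]
    rw [hc] at h
    linarith
  have hKle : K ≤ Kb := by
    have h1 : qA ≤ ((m : ℝ) + 2) * (e0 + 1) := by
      have hδr1 : δr ≤ 1 := hδrle.trans hδ₀1
      have hq1 : qΨ ≤ e0 + 1 := by linarith
      exact hqAr.trans (mul_le_mul_of_nonneg_left hq1 (by positivity))
    have h3 : cB * nA ≤ cB * ((m : ℝ) + 2) := mul_le_mul_of_nonneg_left hnAle hcB0
    calc K ≤ ((m : ℝ) + 2) * (qA + cB * nA) := hKr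
      _ ≤ ((m : ℝ) + 2) * (((m : ℝ) + 2) * (e0 + 1) + cB * ((m : ℝ) + 2)) := by gcongr
      _ = Kb := by rw [hKb]
  -- the Wagner–Feynman form inequality and the polar cross-term bound
  set B : ℝ := formRe v L ψ NΨ with hB
  have hWF : qA + qC ≤ D + qΨ + 2 * B := by
    have h := wagnerFeynman_form_le hL hw hint hn hψc hψEtop
    rw [hψ1, ENNReal.toReal_one, mul_one] at h
    exact h
  have hBabs : |B - e0 * nA| ≤ Real.sqrt δr * Real.sqrt K := by
    have hnear : (qform v L ψ).toReal ≤ E₀.toReal * (normSq L ψ).toReal + δr := by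
      rw [hψ1, ENNReal.toReal_one, mul_one]; exact hq
    have h := abs_formRe_sub_le hL hw hψc hNΨc hψEtop hNΨEtop hE2 hδr0 hnear
    have hi : innerRe L ψ NΨ = nA := innerRe_numOp hL n hψc
    rwa [hi] at h
  -- ===== the real-arithmetic core (`e1 := Tm`, `e3 := Tp`) =====
  intro nk
  exact KLS.real_core hb hη rfl hchanP hchanM hWF hq hBabs hKle hslackδ

end KLS

/-- **Stub S4' of the line `two-sector-gd-transfer` (v7)**: the Kennedy–Lieb–Shastry moment inequality at a
near-minimiser with free thresholds, `KLSMomentForT v`, for every integrable admissible pair potential `v`. -/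
theorem stub_klsNearMinimiserT : KLSNearMinimiserT :=
  fun v hv hint => KLS.klsMomentForT v hv hint

end Summit.AtomisticToContinuum.BoseEinsteinCondensation.Cruxes.PeriodicIRBound.TwoSectorGdTransfer

end
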